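/-
COR-CM (cell pub-hodgecm2, stage 2 of the Hodge ladder) — X_Γ-side «Albanese dictionary» for the isotypic blocks
`U_Ψ(Γ) = Universe.Uiso` of the model universe of record (ROUTES-B01 §7 L2-C; [Liu2021] Lemma 2.4 (1) / Thm 4.18 (1)).
Written by the binder seat pub-hodgecm2-b10 (prover-pub-hodgecm2-b10-g17-0), count-neutral own lane (CLAIM ALBANESE-EXIST,
3/3), over the Literature bricks `Motives/AlbaneseExistenceComplex` (p254248), `Motives/AlbaneseRationalCohomology`
(p254738) and `Motives/AlbanesePullbackSpan`.  Theorems only; nothing cited as a record; nothing asserted; no binder row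
touched; nothing under `CorCM/B01/` (own-b01's pen) is edited or restated.
-/
import Summits.HodgeConjecture.CorCM.Model.PerLConeFacts
import Literature.AlgebraicGeometry.Motives.AlbanesePullbackSpan
import HarnessLib

/-!
# `Uiso` through the Albanese variety of the Picard modular surface (model universe)

ON THE MODEL UNIVERSE `U = Model.universeOf hHD hI hU h₃` (and the universe of record
`Model.picardCMUniverse hHD hI h₁ h₃`): the isotypic block
`U.Uiso Γ K Ψ σ = span_ℂ {F^* α | F : P_Γ → A_{(K,Ψ)}, α ∈ H^{1,0}(A_{(K,Ψ)})_σ}` of the realised Picard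
modular surface `P_Γ = Var.scheme hU h₃ (.pms (pmsCode L ι₁ V Γ))` is read through the ALBANESE VARIETY of
`P_Γ` — which exists in the tree since `Motives.nonempty_jacobian_of_isSmoothProjective_complex_of_dim`
(every smooth projective complex variety has a `Motives.Jacobian`, the point-free Albanese datum) — by
instantiating the scheme-level dictionary `Motives/AlbanesePullbackSpan` at
`A := A_{(K,Ψ)}` (the realised CM abelian variety `(cmRealisation h₃ (cmCode K Ψ)).AV`) and
`E := U.alphaLine K Ψ σ` (the holomorphic `σ`-eigenline):

* `nonempty_jacobian_scheme` — every variety of the model universe has an Albanese datum;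
* `Uiso_eq_span_baseChange_map` — `U.Uiso` on the tree's carriers (`rfl`);
* `Uiso_eq_map_abelJacobi` — **`U_Ψ(Γ)_σ = ((f^P)^* ⊗ ℂ) (span_ℂ {(u^* ⊗ ℂ) α | u ∈ Hom(Alb P_Γ, A_{(K,Ψ)}),
  α ∈ H^{1,0}(A_{(K,Ψ)})_σ})`**; `exists_baseChange_map_abelJacobi_eq_of_mem_Uiso` — every isotypic class
  comes from `ℂ ⊗ H¹(Alb P_Γ; ℚ)`;
* `Uiso_ne_bot_iff_exists_hom` — **`U_Ψ(Γ)_σ ≠ 0` iff SOME homomorphism `u : Alb(P_Γ) → A_{(K,Ψ)}` pulls the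
  holomorphic `σ`-eigenline back non-trivially** (`(f^P)^* ⊗ ℂ` is injective:
  `Jacobian.injective_baseChange_bettiCohomology_map_abelJacobi_one_of_dim`);
* `Uiso_ne_bot_of_surjective_hom` — **a SURJECTIVE homomorphism `Alb(P_Γ) ↠ A_{(K,Ψ)}` gives
  `U_Ψ(Γ)_σ ≠ 0` for every `σ ∈ Ψ`** (the `σ`-eigenline is a non-zero line of type `(1,0)`, rows M13/M14;
  `u^* ⊗ ℂ` injective for surjective `u`, Voisin I Lemma 7.28), with the explicit non-zero class
  `U.pullC (f^P ≫ u) 1 α` (`pullC_abelJacobi_comp_mem_Uiso`, `pullC_abelJacobi_comp_ne_zero`);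
  `Uiso_ne_bot_of_hom_ne_zero_of_isSimple` — for SIMPLE `A_{(K,Ψ)}` (primitive `Ψ`) a NON-ZERO homomorphism
  suffices (Mumford §19: non-zero homs to a simple abelian variety are onto); conversely
  `exists_hom_ne_zero_of_Uiso_ne_bot` — `U_Ψ(Γ)_σ ≠ 0` forces `Hom(Alb(P_Γ), A_{(K,Ψ)}) ≠ 0`, whence the
  equivalence **`Uiso_ne_bot_iff_exists_hom_ne_zero_of_isSimple`**: at a simple `A_{(K,Ψ)}` and `σ ∈ Ψ`,
  `U_Ψ(Γ)_σ ≠ 0 ↔ Hom(Alb(P_Γ), A_{(K,Ψ)}) ≠ 0` (the simplicity hypothesis is in fact unnecessary: own-b01's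
  row D0 `Universe.Uiso_ne_bot_iff` of `B01/FaceSupplyAlbanese` — `U_Ψ(Γ)_σ ≠ 0 ↔ ∃ F, U.pull F 1 ≠ 0`, from
  `Fact_H1_rank` — composed with `Model.exists_mor_pull_ne_zero_iff_exists_hom_ne_zero` of the sibling file
  `Geometry/MorphismsViaAlbanese` gives it for every `A_{(K,Ψ)}`; that composition lives on the `B01/` side);
* the same on `picardCMUniverse hHD hI h₁ h₃`.

USE (B01-S `Universe.FaceSupply`, no row touched, nothing filed under `B01/`): SUPPLY asks for non-zero
classes in `U_{ψ₀}(Γ)_{ι₁}` and `U_{ψ₁}(Γ)_{ι₁}` at some level; by `picardCMUniverse_Uiso_ne_bot_of_surjective_hom`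
it is implied by «at some level `Γ`, `A_{(F,ψ₀)}` and `A_{(F,ψ₁)}` are quotients of `Alb(P_Γ)`» (`ι₁ ∈ ψᵢ` by
admissibility, `CM.Lemmas.admissible_mem_psi`) — the shape of Murty–Ramakrishnan 1992 / [Liu2021] Cor. 4.20
(`A_K ∼ ∏_μ A_μ^{d(μ,K)}` with `d(μ,K) ≠ 0`): the X_Γ-geometry of SUPPLY is discharged; what remains is a
statement about `Hom(Alb(P_Γ), A_Ψ)`.
-/

noncomputable section

open scoped TensorProduct
open CategoryTheory AlgebraicGeometry Module

namespace Summit.HodgeConjecture.CorCM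

open Literature.AlgebraicGeometry.Motives
open Literature.AlgebraicGeometry.HodgeTheory
open Literature.NumberTheory.Automorphic.PicardCM

namespace Model

/-! ### Albanese data of the varieties of the universe -/

/-- **Every variety of the model universe has an Albanese datum** (`Motives.Jacobian`): all of them are
smooth projective complex varieties (`Var.isSmoothProjective`), and every smooth projective complex
variety has one (`nonempty_jacobian_of_isSmoothProjective_complex_of_dim`). In particular the realised
Picard modular surface `P_Γ` has an Albanese variety `Alb(P_Γ)`. -/
theorem nonempty_jacobian_scheme (hU : BallQuotientUniformisedDatum) (h₃ : CMAbelianVarietyRealised) (v : Var) :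
    Nonempty (Jacobian (Var.scheme hU h₃ v)) :=
  nonempty_jacobian_of_isSmoothProjective_complex_of_dim _ (Var.isSmoothProjective hU h₃ v)

section Dictionary

variable {hHD : exists_isReal_hodgeModel} {hI : hodgePQ_independent_of_hodgeModel}
  {hU : BallQuotientUniformisedDatum} {h₃ : CMAbelianVarietyRealised}
variable {L : CMField} {ι₁ : L →+* ℂ} {V : HermSpace3 L ι₁} (Γ : Level V)
  (K : CMField) (Ψ : CMType K) (σ : K →+* ℂ)
  (𝒥 : Jacobian (Var.scheme hU h₃ (.pms (pmsCode L ι₁ V Γ))))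

/-- **`U_Ψ(Γ)_σ` on the tree's carriers** (`rfl`): the `ℂ`-span, in `ℂ ⊗ H¹(P_Γ(ℂ); ℚ)` of the realised
surface, of the classes `(F^* ⊗ ℂ) α`, `F` a morphism from the realised surface to the realised abelian
variety `A_{(K,Ψ)}`, `α` in the holomorphic `σ`-eigenline. -/
theorem Uiso_eq_span_baseChange_map :
    (universeOf hHD hI hU h₃).Uiso Γ K Ψ σ =
      Submodule.span ℂ {ω : ℂ ⊗[ℚ] bettiCohomology (Var.scheme hU h₃ (.pms (pmsCode L ι₁ V Γ))) 1 |
        ∃ (F : Var.scheme hU h₃ (.pms (pmsCode L ι₁ V Γ)) ⟶ (cmRealisation h₃ (cmCode K Ψ)).AV.X)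
          (α : ℂ ⊗[ℚ] bettiCohomology (cmRealisation h₃ (cmCode K Ψ)).AV.X 1),
          α ∈ ((universeOf hHD hI hU h₃).alphaLine K Ψ σ :
            Submodule ℂ (ℂ ⊗[ℚ] bettiCohomology (cmRealisation h₃ (cmCode K Ψ)).AV.X 1)) ∧
          ω = (bettiCohomology.map F 1).hom.baseChange ℂ α} :=
  rfl

/-- **`U_Ψ(Γ)_σ` through the Albanese variety**: the isotypic block is the image under `(f^P)^* ⊗ ℂ` of the
span of the pull-backs `(u^* ⊗ ℂ) α` of holomorphic `σ`-eigen one-forms along HOMOMORPHISMS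
`u : Alb(P_Γ) → A_{(K,Ψ)}` (`Jacobian.span_baseChange_pull_eq_map_abelJacobi`). -/
theorem Uiso_eq_map_abelJacobi (P : AlgPoints (Var.scheme hU h₃ (.pms (pmsCode L ι₁ V Γ))) ℂ) :
    (universeOf hHD hI hU h₃).Uiso Γ K Ψ σ =
      (Submodule.span ℂ {β : ℂ ⊗[ℚ] bettiCohomology 𝒥.J.X 1 |
        ∃ (u : 𝒥.J ⟶ (cmRealisation h₃ (cmCode K Ψ)).AV)
          (α : ℂ ⊗[ℚ] bettiCohomology (cmRealisation h₃ (cmCode K Ψ)).AV.X 1),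
          α ∈ ((universeOf hHD hI hU h₃).alphaLine K Ψ σ :
            Submodule ℂ (ℂ ⊗[ℚ] bettiCohomology (cmRealisation h₃ (cmCode K Ψ)).AV.X 1)) ∧
          β = (bettiCohomology.map u.hom.hom.hom 1).hom.baseChange ℂ α}).map
        ((bettiCohomology.map (𝒥.abelJacobi P) 1).hom.baseChange ℂ) :=
  (Uiso_eq_span_baseChange_map Γ K Ψ σ).trans
    (𝒥.span_baseChange_pull_eq_map_abelJacobi P (cmRealisation h₃ (cmCode K Ψ)).AV _)

/-- Every class of `U_Ψ(Γ)_σ` comes from `ℂ ⊗ H¹(Alb P_Γ; ℚ)` under `(f^P)^* ⊗ ℂ`. -/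
theorem exists_baseChange_map_abelJacobi_eq_of_mem_Uiso
    (P : AlgPoints (Var.scheme hU h₃ (.pms (pmsCode L ι₁ V Γ))) ℂ)
    {ω : (universeOf hHD hI hU h₃).CohC ((universeOf hHD hI hU h₃).pms L ι₁ V Γ) 1}
    (hω : ω ∈ (universeOf hHD hI hU h₃).Uiso Γ K Ψ σ) :
    ∃ β : ℂ ⊗[ℚ] bettiCohomology 𝒥.J.X 1, (bettiCohomology.map (𝒥.abelJacobi P) 1).hom.baseChange ℂ β = ω :=
  LinearMap.mem_range.1
    (𝒥.span_baseChange_pull_le_range_abelJacobi P (cmRealisation h₃ (cmCode K Ψ)).AV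
      ((universeOf hHD hI hU h₃).alphaLine K Ψ σ) hω)

/-- **`U_Ψ(Γ)_σ ≠ 0` iff SOME homomorphism `u : Alb(P_Γ) → A_{(K,Ψ)}` pulls the holomorphic `σ`-eigenline
back non-trivially** (`(f^P)^* ⊗ ℂ` is injective on the smooth projective surface `P_Γ`) — the X_Γ-free
form of «`P_Γ` carries a non-zero `B_Ψ`-isotypic `σ`-eigen one-form». -/
theorem Uiso_ne_bot_iff_exists_hom :
    (universeOf hHD hI hU h₃).Uiso Γ K Ψ σ ≠ ⊥ ↔
      ∃ u : 𝒥.J ⟶ (cmRealisation h₃ (cmCode K Ψ)).AV,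
        ((universeOf hHD hI hU h₃).alphaLine K Ψ σ :
            Submodule ℂ (ℂ ⊗[ℚ] bettiCohomology (cmRealisation h₃ (cmCode K Ψ)).AV.X 1)).map
          ((bettiCohomology.map u.hom.hom.hom 1).hom.baseChange ℂ) ≠ ⊥ :=
  𝒥.span_baseChange_pull_ne_bot_iff (cmRealisation h₃ (cmCode K Ψ)).AV _
    (Var.isSmoothProjective hU h₃ (.pms (pmsCode L ι₁ V Γ)))

/-- **`U_Ψ(Γ)_σ ≠ 0` forces `Hom(Alb(P_Γ), A_{(K,Ψ)}) ≠ 0`**: the zero homomorphism kills `ℂ ⊗ H¹`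
(`Jacobian.exists_hom_ne_zero_of_span_baseChange_pull_ne_bot`). -/
theorem exists_hom_ne_zero_of_Uiso_ne_bot (h : (universeOf hHD hI hU h₃).Uiso Γ K Ψ σ ≠ ⊥) :
    ∃ u : 𝒥.J ⟶ (cmRealisation h₃ (cmCode K Ψ)).AV, u ≠ 0 :=
  𝒥.exists_hom_ne_zero_of_span_baseChange_pull_ne_bot (cmRealisation h₃ (cmCode K Ψ)).AV _
    (Var.isSmoothProjective hU h₃ (.pms (pmsCode L ι₁ V Γ))) h

/-- The holomorphic `σ`-eigenline of `A_{(K,Ψ)}` is non-zero for `σ ∈ Ψ` (rows M13 `Fact_eigenLine`,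
M14 `Fact_alphaLine` of the model universe). -/
theorem alphaLine_ne_bot (hσ : σ ∈ Ψ.1) : (universeOf hHD hI hU h₃).alphaLine K Ψ σ ≠ ⊥ := by
  rw [((universeOf_fact_alphaLine hHD hI hU h₃) K Ψ σ).1 hσ]
  intro h
  have h1 := (universeOf_fact_eigenLine hHD hI hU h₃) K Ψ σ
  rw [h, finrank_bot] at h1
  exact zero_ne_one h1

/-- **A surjective homomorphism `Alb(P_Γ) ↠ A_{(K,Ψ)}` supplies non-zero isotypic one-forms**: if some
`u : Alb(P_Γ) → A_{(K,Ψ)}` is surjective then `U_Ψ(Γ)_σ ≠ 0` for every `σ ∈ Ψ`. This is the form in which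
an isogeny decomposition `Alb(P_Γ) ∼ ∏ A_μ^{d(μ,Γ)}` with `A_{(K,Ψ)}` among the factors
(Murty–Ramakrishnan 1992; [Liu2021] Cor. 4.20) feeds the SUPPLY input `Universe.FaceSupply` of junction
B01. -/
theorem Uiso_ne_bot_of_surjective_hom (u : 𝒥.J ⟶ (cmRealisation h₃ (cmCode K Ψ)).AV)
    [Surjective (AbelianVariety.Hom.toSchemeHom u)] (hσ : σ ∈ Ψ.1) :
    (universeOf hHD hI hU h₃).Uiso Γ K Ψ σ ≠ ⊥ :=
  𝒥.span_baseChange_pull_ne_bot_of_surjective (cmRealisation h₃ (cmCode K Ψ)).AV _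
    (Var.isSmoothProjective hU h₃ (.pms (pmsCode L ι₁ V Γ))) u (alphaLine_ne_bot K Ψ σ hσ)

/-- **A non-zero homomorphism `Alb(P_Γ) → A_{(K,Ψ)}` to a SIMPLE `A_{(K,Ψ)}` supplies non-zero isotypic
one-forms** (`U_Ψ(Γ)_σ ≠ 0` for `σ ∈ Ψ`): a non-zero homomorphism to a simple abelian variety is surjective
(Mumford §19, the tree's `AbelianVariety.surjective_of_isSimple`). For a PRIMITIVE CM type `Ψ` the CM abelian
variety `A_{(K,Ψ)}` is simple, so at primitive period types SUPPLY reads «`Hom(Alb(P_Γ), A_{(K,Ψ)}) ≠ 0`». -/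
theorem Uiso_ne_bot_of_hom_ne_zero_of_isSimple (u : 𝒥.J ⟶ (cmRealisation h₃ (cmCode K Ψ)).AV)
    (hA : (cmRealisation h₃ (cmCode K Ψ)).AV.IsSimple) (hu : u ≠ 0) (hσ : σ ∈ Ψ.1) :
    (universeOf hHD hI hU h₃).Uiso Γ K Ψ σ ≠ ⊥ :=
  haveI := AbelianVariety.surjective_of_isSimple u hA hu
  Uiso_ne_bot_of_surjective_hom Γ K Ψ σ 𝒥 u hσ

/-- **The Albanese dictionary at a simple `A_{(K,Ψ)}`** (e.g. `Ψ` primitive): for `σ ∈ Ψ`,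
`U_Ψ(Γ)_σ ≠ 0` iff `Hom(Alb(P_Γ), A_{(K,Ψ)}) ≠ 0`
(`Jacobian.span_baseChange_pull_ne_bot_iff_exists_hom_ne_zero`). -/
theorem Uiso_ne_bot_iff_exists_hom_ne_zero_of_isSimple (hA : (cmRealisation h₃ (cmCode K Ψ)).AV.IsSimple)
    (hσ : σ ∈ Ψ.1) :
    (universeOf hHD hI hU h₃).Uiso Γ K Ψ σ ≠ ⊥ ↔ ∃ u : 𝒥.J ⟶ (cmRealisation h₃ (cmCode K Ψ)).AV, u ≠ 0 :=
  𝒥.span_baseChange_pull_ne_bot_iff_exists_hom_ne_zero (cmRealisation h₃ (cmCode K Ψ)).AV _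
    (Var.isSmoothProjective hU h₃ (.pms (pmsCode L ι₁ V Γ))) hA (alphaLine_ne_bot K Ψ σ hσ)

/-- The explicit class: `U.pullC (f^P ≫ u) 1 α ∈ U_Ψ(Γ)_σ` for `α` in the holomorphic `σ`-eigenline
(a generator, `f^P ≫ u : P_Γ → A_{(K,Ψ)}` being a morphism of the universe). -/
theorem pullC_abelJacobi_comp_mem_Uiso (P : AlgPoints (Var.scheme hU h₃ (.pms (pmsCode L ι₁ V Γ))) ℂ)
    (u : 𝒥.J ⟶ (cmRealisation h₃ (cmCode K Ψ)).AV)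
    {α : (universeOf hHD hI hU h₃).CohC ((universeOf hHD hI hU h₃).cmAV K Ψ) 1}
    (hα : α ∈ (universeOf hHD hI hU h₃).alphaLine K Ψ σ) :
    (universeOf hHD hI hU h₃).pullC
        (show (universeOf hHD hI hU h₃).Mor ((universeOf hHD hI hU h₃).pms L ι₁ V Γ)
          ((universeOf hHD hI hU h₃).cmAV K Ψ) from 𝒥.abelJacobi P ≫ u.hom.hom.hom) 1 α ∈
      (universeOf hHD hI hU h₃).Uiso Γ K Ψ σ :=
  Submodule.subset_span ⟨_, α, hα, rfl⟩

/-- The explicit class is non-zero: `U.pullC (f^P ≫ u) 1 α ≠ 0` for SURJECTIVE `u : Alb(P_Γ) ↠ A_{(K,Ψ)}`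
and `α ≠ 0` (`(f^P)^* ⊗ ℂ` and `u^* ⊗ ℂ` are injective). -/
theorem pullC_abelJacobi_comp_ne_zero (P : AlgPoints (Var.scheme hU h₃ (.pms (pmsCode L ι₁ V Γ))) ℂ)
    (u : 𝒥.J ⟶ (cmRealisation h₃ (cmCode K Ψ)).AV) [Surjective (AbelianVariety.Hom.toSchemeHom u)]
    {α : (universeOf hHD hI hU h₃).CohC ((universeOf hHD hI hU h₃).cmAV K Ψ) 1} (hα0 : α ≠ 0) :
    (universeOf hHD hI hU h₃).pullC
        (show (universeOf hHD hI hU h₃).Mor ((universeOf hHD hI hU h₃).pms L ι₁ V Γ)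
          ((universeOf hHD hI hU h₃).cmAV K Ψ) from 𝒥.abelJacobi P ≫ u.hom.hom.hom) 1 α ≠ 0 :=
  𝒥.baseChange_map_abelJacobi_comp_ne_zero P (cmRealisation h₃ (cmCode K Ψ)).AV
    (Var.isSmoothProjective hU h₃ (.pms (pmsCode L ι₁ V Γ))) u hα0

end Dictionary

/-! ### On the universe of record `picardCMUniverse hHD hI h₁ h₃` -/

section PicardCM

variable {hHD : exists_isReal_hodgeModel} {hI : hodgePQ_independent_of_hodgeModel}
  {h₁ : BallQuotientUniformised} {h₃ : CMAbelianVarietyRealised}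
variable {L : CMField} {ι₁ : L →+* ℂ} {V : HermSpace3 L ι₁} (Γ : Level V)
  (K : CMField) (Ψ : CMType K) (σ : K →+* ℂ)
  (𝒥 : Jacobian (Var.scheme (ballQuotientUniformisedDatum_of h₁) h₃ (.pms (pmsCode L ι₁ V Γ))))

/-- `Uiso_ne_bot_iff_exists_hom` on the universe of record: `U_Ψ(Γ)_σ ≠ 0` iff some homomorphism
`Alb(P_Γ) → A_{(K,Ψ)}` pulls the holomorphic `σ`-eigenline back non-trivially. -/
theorem picardCMUniverse_Uiso_ne_bot_iff_exists_hom :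
    (picardCMUniverse hHD hI h₁ h₃).Uiso Γ K Ψ σ ≠ ⊥ ↔
      ∃ u : 𝒥.J ⟶ (cmRealisation h₃ (cmCode K Ψ)).AV,
        ((picardCMUniverse hHD hI h₁ h₃).alphaLine K Ψ σ :
            Submodule ℂ (ℂ ⊗[ℚ] bettiCohomology (cmRealisation h₃ (cmCode K Ψ)).AV.X 1)).map
          ((bettiCohomology.map u.hom.hom.hom 1).hom.baseChange ℂ) ≠ ⊥ :=
  Uiso_ne_bot_iff_exists_hom Γ K Ψ σ 𝒥

/-- `Uiso_ne_bot_of_surjective_hom` on the universe of record: a surjective `Alb(P_Γ) ↠ A_{(K,Ψ)}` gives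
`U_Ψ(Γ)_σ ≠ 0` for `σ ∈ Ψ`. -/
theorem picardCMUniverse_Uiso_ne_bot_of_surjective_hom (u : 𝒥.J ⟶ (cmRealisation h₃ (cmCode K Ψ)).AV)
    [Surjective (AbelianVariety.Hom.toSchemeHom u)] (hσ : σ ∈ Ψ.1) :
    (picardCMUniverse hHD hI h₁ h₃).Uiso Γ K Ψ σ ≠ ⊥ :=
  Uiso_ne_bot_of_surjective_hom Γ K Ψ σ 𝒥 u hσ

/-- `Uiso_ne_bot_of_hom_ne_zero_of_isSimple` on the universe of record: a NON-ZERO homomorphism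
`Alb(P_Γ) → A_{(K,Ψ)}` with `A_{(K,Ψ)}` simple gives `U_Ψ(Γ)_σ ≠ 0` for `σ ∈ Ψ`. -/
theorem picardCMUniverse_Uiso_ne_bot_of_hom_ne_zero_of_isSimple
    (u : 𝒥.J ⟶ (cmRealisation h₃ (cmCode K Ψ)).AV) (hA : (cmRealisation h₃ (cmCode K Ψ)).AV.IsSimple)
    (hu : u ≠ 0) (hσ : σ ∈ Ψ.1) :
    (picardCMUniverse hHD hI h₁ h₃).Uiso Γ K Ψ σ ≠ ⊥ :=
  Uiso_ne_bot_of_hom_ne_zero_of_isSimple Γ K Ψ σ 𝒥 u hA hu hσ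

/-- `exists_hom_ne_zero_of_Uiso_ne_bot` on the universe of record: `U_Ψ(Γ)_σ ≠ 0` forces
`Hom(Alb(P_Γ), A_{(K,Ψ)}) ≠ 0`. -/
theorem picardCMUniverse_exists_hom_ne_zero_of_Uiso_ne_bot
    (h : (picardCMUniverse hHD hI h₁ h₃).Uiso Γ K Ψ σ ≠ ⊥) :
    ∃ u : 𝒥.J ⟶ (cmRealisation h₃ (cmCode K Ψ)).AV, u ≠ 0 :=
  exists_hom_ne_zero_of_Uiso_ne_bot Γ K Ψ σ 𝒥 h

/-- `Uiso_ne_bot_iff_exists_hom_ne_zero_of_isSimple` on the universe of record: at a simple `A_{(K,Ψ)}`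
and `σ ∈ Ψ`, `U_Ψ(Γ)_σ ≠ 0` iff `Hom(Alb(P_Γ), A_{(K,Ψ)}) ≠ 0`. -/
theorem picardCMUniverse_Uiso_ne_bot_iff_exists_hom_ne_zero_of_isSimple
    (hA : (cmRealisation h₃ (cmCode K Ψ)).AV.IsSimple) (hσ : σ ∈ Ψ.1) :
    (picardCMUniverse hHD hI h₁ h₃).Uiso Γ K Ψ σ ≠ ⊥ ↔
      ∃ u : 𝒥.J ⟶ (cmRealisation h₃ (cmCode K Ψ)).AV, u ≠ 0 :=
  Uiso_ne_bot_iff_exists_hom_ne_zero_of_isSimple Γ K Ψ σ 𝒥 hA hσ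

end PicardCM

end Model

end Summit.HodgeConjecture.CorCM

end
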